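import Mathlib.Topology.Baire.Lemmas
import Mathlib.Topology.Baire.CompleteMetrizable
import Literature.Geometry.Lorentzian.FinalState
import Literature.Geometry.Lorentzian.Genericity
import HarnessLib

/-!
# Route PhotonSphereChannels · crux `TameCensorship` (stmt-FinalStateConjecture-17431) · line `Sketch`, skeleton v9 ·
# stub `stub_residualAnd`: RESIDUAL escapability is closed under ∧ (def-free, abstract in Q₁ Q₂)

Helper file (`--supports stmt-FinalStateConjecture-17431`) of line `Sketch` (lead c4, 2026-08-17, wave 2): one brick of the
RESIDUAL legend. Residual escapability of a property `Q` of initial data at a datum `d`: every compactly supported smooth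
admissible probe through `d` enriches, along an injective linear map of parameter spaces, to one along all of whose further
enrichments a RESIDUAL (comeagre, `residual (EuclideanSpace ℝ (Fin p))`, Mathlib `Topology/GDelta/Basic`) set of radial
directions has `Q` for all small non-zero parameters — the v9 weakening of the open-dense ("robust") legend of v4–v8.
This file: residual escapability is CLOSED UNDER `∧`, for two abstract properties `Q₁`, `Q₂` (def-free; the registered
stub signature inlines the probe legend). Proof idea (pure finite-dimensional bookkeeping, the analogue of the landed
open-dense brick `stub_robustAnd`): enrich the given probe for `Q₁`, enrich the result for `Q₂`, answer with the composite
linear map; a further enrichment of the second is one of the first along the composite map, so it carries two residual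
direction sets, and `residual _` is a filter (`Filter.inter_mem`), so their intersection is residual; take the smaller
radius. No Baire category theorem is needed at this step (it enters only when a residual set is USED, in the
neighbouring stub `stub_pathOfResidual`).

References: folklore (filters are closed under binary intersection); the prevalence/genericity framing follows
B. R. Hunt, T. Sauer, J. A. Yorke, *Prevalence*, Bull. AMS 27 (1992), Fact 3″, and D. Christodoulou, CQG 16 (1999) A23.
-/

set_option linter.dupNamespace false

open Literature.Geometry.Lorentzian
open scoped Manifold ContDiff Topology
open Filter Set Function

noncomputable section

namespace Summit.FinalStateConjecture.FinalStateConjecture.Theorems.PhotonSphereChannels.TameCensorshipUnwind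

/-- **Stub `stub_residualAnd` of line `Sketch` (skeleton v9) for the crux `PhotonSphereChannels.TameCensorship`
(stmt-FinalStateConjecture-17431): residual escapability is CLOSED UNDER CONJUNCTION.** For an arbitrary datum `d` and
two properties `Q₁`, `Q₂` of initial data: if every compactly supported smooth admissible probe through `d` enriches
(along an injective linear map of parameter spaces) to one along all of whose further enrichments a residual set of
radial directions has `Q₁` for all small non-zero parameters, and likewise for `Q₂`, then likewise for `Q₁ ∧ Q₂`.
Proof: enrich for `Q₁` (getting `G₁`, `L₁`), enrich `G₁` for `Q₂` (getting `G₂`, `L₂`), and answer with `G₂` and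
`L₂ ∘ L₁`; a further enrichment `G₃` of `G₂` along `L'` is one of `G₁` along `L' ∘ L₂`, so both hypotheses yield residual
direction sets `U₁`, `U₂`; their intersection is residual because `residual _` is a filter (`Filter.inter_mem`), and on
it both properties hold for `0 < |t| < min δ₁ δ₂`. [folklore] -/
theorem stub_residualAnd :
    ∀ (X : Type) [TopologicalSpace X] [ChartedSpace E3 X] [IsManifold (𝓡 3) ∞ X] [T2Space X]
    [SecondCountableTopology X] [ConnectedSpace X] (d : InitialDataSet (𝓡 3) X) (Q₁ Q₂ : InitialDataSet (𝓡 3) X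
    → Prop), (∀ (m : ℕ) (G : EuclideanSpace ℝ (Fin m) → InitialDataSet (𝓡 3) X),
    (InitialDataSet.IsSmoothDataFamily m G ∧ G 0 = d ∧ (∀ c, G c ∈ admissibleVacuumData X) ∧ ∃ K : Set X,
    IsCompact K ∧ ∀ c, ∀ x ∉ K, (G c).h.inner x = d.h.inner x ∧ (G c).k x = d.k x) → ∃ (n : ℕ) (G₁ :
    EuclideanSpace ℝ (Fin n) → InitialDataSet (𝓡 3) X) (L : EuclideanSpace ℝ (Fin m) →ₗ[ℝ] EuclideanSpace ℝ (Fin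
    n)), Function.Injective L ∧ (InitialDataSet.IsSmoothDataFamily n G₁ ∧ G₁ 0 = d ∧ (∀ c, G₁ c ∈
    admissibleVacuumData X) ∧ ∃ K : Set X, IsCompact K ∧ ∀ c, ∀ x ∉ K, (G₁ c).h.inner x = d.h.inner x ∧ (G₁ c).k
    x = d.k x) ∧ (∀ c, G₁ (L c) = G c) ∧ ∀ (p : ℕ) (G₂ : EuclideanSpace ℝ (Fin p) → InitialDataSet (𝓡 3) X) (L'
    : EuclideanSpace ℝ (Fin n) →ₗ[ℝ] EuclideanSpace ℝ (Fin p)), Function.Injective L' →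
    (InitialDataSet.IsSmoothDataFamily p G₂ ∧ G₂ 0 = d ∧ (∀ c, G₂ c ∈ admissibleVacuumData X) ∧ ∃ K : Set X,
    IsCompact K ∧ ∀ c, ∀ x ∉ K, (G₂ c).h.inner x = d.h.inner x ∧ (G₂ c).k x = d.k x) → (∀ c, G₂ (L' c) = G₁ c) →
    ∃ U : Set (EuclideanSpace ℝ (Fin p)), U ∈ residual (EuclideanSpace ℝ (Fin p)) ∧ ∀ v ∈ U, ∃ δ : ℝ, 0 < δ ∧ ∀
    t : ℝ, t ≠ 0 → |t| < δ → Q₁ (G₂ (t • v))) → (∀ (m : ℕ) (G : EuclideanSpace ℝ (Fin m) → InitialDataSet (𝓡 3)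
    X), (InitialDataSet.IsSmoothDataFamily m G ∧ G 0 = d ∧ (∀ c, G c ∈ admissibleVacuumData X) ∧ ∃ K : Set X,
    IsCompact K ∧ ∀ c, ∀ x ∉ K, (G c).h.inner x = d.h.inner x ∧ (G c).k x = d.k x) → ∃ (n : ℕ) (G₁ :
    EuclideanSpace ℝ (Fin n) → InitialDataSet (𝓡 3) X) (L : EuclideanSpace ℝ (Fin m) →ₗ[ℝ] EuclideanSpace ℝ (Fin
    n)), Function.Injective L ∧ (InitialDataSet.IsSmoothDataFamily n G₁ ∧ G₁ 0 = d ∧ (∀ c, G₁ c ∈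
    admissibleVacuumData X) ∧ ∃ K : Set X, IsCompact K ∧ ∀ c, ∀ x ∉ K, (G₁ c).h.inner x = d.h.inner x ∧ (G₁ c).k
    x = d.k x) ∧ (∀ c, G₁ (L c) = G c) ∧ ∀ (p : ℕ) (G₂ : EuclideanSpace ℝ (Fin p) → InitialDataSet (𝓡 3) X) (L'
    : EuclideanSpace ℝ (Fin n) →ₗ[ℝ] EuclideanSpace ℝ (Fin p)), Function.Injective L' →
    (InitialDataSet.IsSmoothDataFamily p G₂ ∧ G₂ 0 = d ∧ (∀ c, G₂ c ∈ admissibleVacuumData X) ∧ ∃ K : Set X,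
    IsCompact K ∧ ∀ c, ∀ x ∉ K, (G₂ c).h.inner x = d.h.inner x ∧ (G₂ c).k x = d.k x) → (∀ c, G₂ (L' c) = G₁ c) →
    ∃ U : Set (EuclideanSpace ℝ (Fin p)), U ∈ residual (EuclideanSpace ℝ (Fin p)) ∧ ∀ v ∈ U, ∃ δ : ℝ, 0 < δ ∧ ∀
    t : ℝ, t ≠ 0 → |t| < δ → Q₂ (G₂ (t • v))) → ∀ (m : ℕ) (G : EuclideanSpace ℝ (Fin m) → InitialDataSet (𝓡 3)
    X), (InitialDataSet.IsSmoothDataFamily m G ∧ G 0 = d ∧ (∀ c, G c ∈ admissibleVacuumData X) ∧ ∃ K : Set X,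
    IsCompact K ∧ ∀ c, ∀ x ∉ K, (G c).h.inner x = d.h.inner x ∧ (G c).k x = d.k x) → ∃ (n : ℕ) (G₁ :
    EuclideanSpace ℝ (Fin n) → InitialDataSet (𝓡 3) X) (L : EuclideanSpace ℝ (Fin m) →ₗ[ℝ] EuclideanSpace ℝ (Fin
    n)), Function.Injective L ∧ (InitialDataSet.IsSmoothDataFamily n G₁ ∧ G₁ 0 = d ∧ (∀ c, G₁ c ∈
    admissibleVacuumData X) ∧ ∃ K : Set X, IsCompact K ∧ ∀ c, ∀ x ∉ K, (G₁ c).h.inner x = d.h.inner x ∧ (G₁ c).k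
    x = d.k x) ∧ (∀ c, G₁ (L c) = G c) ∧ ∀ (p : ℕ) (G₂ : EuclideanSpace ℝ (Fin p) → InitialDataSet (𝓡 3) X) (L'
    : EuclideanSpace ℝ (Fin n) →ₗ[ℝ] EuclideanSpace ℝ (Fin p)), Function.Injective L' →
    (InitialDataSet.IsSmoothDataFamily p G₂ ∧ G₂ 0 = d ∧ (∀ c, G₂ c ∈ admissibleVacuumData X) ∧ ∃ K : Set X,
    IsCompact K ∧ ∀ c, ∀ x ∉ K, (G₂ c).h.inner x = d.h.inner x ∧ (G₂ c).k x = d.k x) → (∀ c, G₂ (L' c) = G₁ c) →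
    ∃ U : Set (EuclideanSpace ℝ (Fin p)), U ∈ residual (EuclideanSpace ℝ (Fin p)) ∧ ∀ v ∈ U, ∃ δ : ℝ, 0 < δ ∧ ∀
    t : ℝ, t ≠ 0 → |t| < δ → (Q₁ (G₂ (t • v)) ∧ Q₂ (G₂ (t • v))) := by
  -- adapted from `stub_robustAnd` (Theorems/PhotonSphereChannelsTameCensorshipRobustAnd.lean)
  intro X _ _ _ _ _ _ d Q₁ Q₂ h₁ h₂ m G hG
  obtain ⟨n₁, G₁, L₁, hL₁, hT₁, hGL₁, hR₁⟩ := h₁ m G hG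
  obtain ⟨n₂, G₂, L₂, hL₂, hT₂, hGL₂, hR₂⟩ := h₂ n₁ G₁ hT₁
  refine ⟨n₂, G₂, L₂.comp L₁, fun a b h => hL₁ (hL₂ h), hT₂,
    fun c => by rw [LinearMap.comp_apply, hGL₂, hGL₁], fun p G₃ L' hL' hT₃ hGL₃ => ?_⟩
  obtain ⟨U₁, hU₁r, hU₁⟩ := hR₁ p G₃ (L'.comp L₂) (fun a b h => hL₂ (hL' h)) hT₃
    (fun c => by rw [LinearMap.comp_apply, hGL₃, hGL₂])
  obtain ⟨U₂, hU₂r, hU₂⟩ := hR₂ p G₃ L' hL' hT₃ hGL₃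
  refine ⟨U₁ ∩ U₂, Filter.inter_mem hU₁r hU₂r, fun v hv => ?_⟩
  obtain ⟨δ₁, hδ₁, hv₁⟩ := hU₁ v hv.1
  obtain ⟨δ₂, hδ₂, hv₂⟩ := hU₂ v hv.2
  exact ⟨min δ₁ δ₂, lt_min hδ₁ hδ₂, fun t ht htδ =>
    ⟨hv₁ t ht (htδ.trans_le (min_le_left _ _)), hv₂ t ht (htδ.trans_le (min_le_right _ _))⟩⟩

end Summit.FinalStateConjecture.FinalStateConjecture.Theorems.PhotonSphereChannels.TameCensorshipUnwind

end
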